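import Summits.BirchSwinnertonDyer.BirchSwinnertonDyer.Theorems.AdditiveKolyvaginRoadLevelSystemsHybrid
import Summits.BirchSwinnertonDyer.BirchSwinnertonDyer.Theorems.AdditiveKolyvaginRoadLevelMembership
import Summits.BirchSwinnertonDyer.BirchSwinnertonDyer.Theorems.AdditiveKolyvaginRoadLevelBasics
import Literature.NumberTheory.EllipticCurves.HeegnerPointsKolyvaginClassesPointsProofs
import HarnessLib

/-!
# Route `AdditiveKolyvaginRoad`, crux `LevelKolyvaginSystemsAdditive` (item stmt-BirchSwinnertonDyer-21396, KS′):
# TRANSFER of a level Kolyvagin system along a mod-`p` CONGRUENCE `H¹(K, E₀[p]) ≃ H¹(K, E[p])`, modulo the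
# identification of local kernels and a BOTTOM TRANSFER of Kolyvagin non-vanishing
# (cell `pub/bsd-wall`, width seat `bsd-wall-akr-p2x-w3` g0 on line `birth`; `--supports stmt-BirchSwinnertonDyer-21396`, helper;
# the lender side of the hybrid socket `AdditiveKolyvaginRoadLevelSystemsHybrid`, for the round-1 crux ideas
# `depleted-shadow-transfer` ∕ `pold-fusion-glue` (lender = the `p`-good shadow `E₀`, `N = p² N₀`) and `epsilon-matched-retyping`
# (lender = a congruent curve of another tame type at `p`))

WHAT. Let `E = W` (the frame's curve) and `E₀ = W₀` (the LENDER) be elliptic curves over `ℚ`, `p` a prime, `K` a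
number field with complex conjugation `c`, and `θ : H¹(K, E₀[p]) ≃ H¹(K, E[p])` an additive isomorphism (meant: the map
induced by a `Γ_ℚ`-isomorphism `E₀[p] ≅ E[p]`, tree `h1Equiv`). HYPOTHESES, all explicit binders: (θc) `θ` intertwines
the actions of `c`; (θ0) `θ` preserves local triviality at every finite place; (θK) `θ` identifies E₀'s and E's KUMMER
conditions at every finite place (at `v ∤ p N N₀` both are «unramified» — tree `mem_unramifiedKer_iff_h1Equiv_mem`; at
`v ∣ N` the ♠-type inputs; at `v ∣ p` THE LOAD-BEARING INPUT of the ideas: parity-forced Lagrangian identity ∕ ε-matching);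
(θT) `θ` identifies the TORIC conditions and (θTr) carries E₀'s TRANSVERSE condition into E's; (Kol)∕(Adm) the Kolyvagin
primes and the Bertolini–Darmon admissible primes of `(E, K, p)` and `(E₀, K, p)` COINCIDE (same residual representation,
`rad(pN) = rad(pN₀)`); `S₀` a level Kolyvagin system for `(E₀, K, p)` (for the `p`-GOOD ordinary shadow: W. Zhang 2014 in
print); (A2) the BOTTOM TRANSFER «some Kolyvagin class of `E₀` is non-zero mod `p` ⟹ some Kolyvagin class of `E` is»
(Kriz–Li congruence of Heegner logarithms + rigidity, or the geometric fusion `E[p] ⊂ S_h` — the ideas' glue). THEN: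

* `mem_selQP_iff_of_congr` — `θ y ∈ Sel_n^μ(E) ⟺ y ∈ Sel_n^μ(E₀)` at every level (indices matched), hence
  `finrank_selQP_eq_of_congr` — the canonical spaces of `E` and `E₀` have the same dimensions at EVERY level (the idea's
  stub (A1) «Selmer identity at every level» REDUCED to the per-place kernel identifications (θK), (θT), (θc));
* `nonempty_levelKolyvaginSystemP_of_congr` — `LevelKolyvaginSystemP W K p Dt β ι c` is inhabited (E's own classes at
  level `∅`, the lender's transported classes above, via `nonempty_levelKolyvaginSystemP_of_upperLevels_of_bottomTransfer`).

HONEST FRAMING: theorems only; 0 definitions, 0 named facts, 0 `sorry`; CONDITIONAL on every displayed binder — in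
particular (θK) at `v ∣ p` and (A2) are the OPEN inputs of the ideas, and `S₀` is in print only for a `p`-good ordinary
lender; the transfer reaches the frames possessing such a lender (II* census: 5 644 ∕ 19 800 classes have a RATIONAL
shadow), not the whole crux. Closes nothing. BSD is not proved by any of this.

References: [cite: WZhang2014, Thm. 4.3, Thm. 7.2, §9] [cite: KrizLi2019, Thm. 1.16, Rem. 1.17] [cite: GrossLMS1991, §4 (4.4)]
[cite: BertoliniDarmon2005, p. 18, §2.2–§2.3].
-/

-- single-conjunct summit: `Summit.BirchSwinnertonDyer.BirchSwinnertonDyer.…` repeats the name by design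
set_option linter.dupNamespace false

noncomputable section

open scoped Classical

namespace Summit.BirchSwinnertonDyer.BirchSwinnertonDyer.Theorems.AdditiveKoly

open WeierstrassCurve NumberField IsDedekindDomain
  Literature.NumberTheory.EllipticCurves Literature.NumberTheory.EllipticCurves.ModularForms
  Literature.NumberTheory.GaloisRepresentations Module
  Summit.BirchSwinnertonDyer.Rank1Residual.X11b.Three.Koly

variable (W W₀ : WeierstrassCurve ℚ) (K : Type) [Field K] [NumberField K] (p : ℕ)
  [W.IsGloballyMinimal] [W₀.IsGloballyMinimal] (c : K ≃ₐ[ℚ] K)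
  [Module (ZMod p) (Vp W K p)] [Module (ZMod p) (Vp W₀ K p)]

/-! ## §1 The canonical spaces correspond under a congruence -/

/-- **`θ y ∈ Sel_n^μ(E) ⟺ y ∈ Sel_n^μ(E₀)`** for an additive isomorphism `θ : H¹(K, E₀[p]) ≃ H¹(K, E[p])` that
intertwines complex conjugation (θc) and identifies the Kummer (θK) and toric (θT) conditions at every finite place,
the admissible primes of the two curves coinciding (the level `n` of `E` is read as the level `eA '' n` of `E₀`); `K`
imaginary quadratic (the archimedean conditions are empty on both sides). Definitional bookkeeping over `mem_selQP_iff`.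
[cite: WZhang2014, §5 (Sel_{𝔭_n})] [cite: BertoliniDarmon2005, §2.3] -/
theorem mem_selQP_iff_of_congr (hK : IsImaginaryQuadratic K) (θ : Vp W₀ K p ≃+ Vp W K p)
    (hθc : ∀ y, θ (conjAct W₀ c ((p ^ 1 : ℕ) : ℤ) y) = conjAct W c ((p ^ 1 : ℕ) : ℤ) (θ y))
    (hθK : ∀ (v : HeightOneSpectrum (𝓞 K)) (y : Vp W₀ K p),
      θ y ∈ selmerLocalKer (W.baseChange K) (v.adicCompletion K) ((p ^ 1 : ℕ) : ℤ) ↔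
        y ∈ selmerLocalKer (W₀.baseChange K) (v.adicCompletion K) ((p ^ 1 : ℕ) : ℤ))
    (hθT : ∀ (v : HeightOneSpectrum (𝓞 K)) (y : Vp W₀ K p),
      θ y ∈ toricLocalKer (W.baseChange K) (v.adicCompletion K) ((p ^ 1 : ℕ) : ℤ) ↔
        y ∈ toricLocalKer (W₀.baseChange K) (v.adicCompletion K) ((p ^ 1 : ℕ) : ℤ))
    (eA : AdmQ W K p ≃ AdmQ W₀ K p) (heA : ∀ q, ((eA q : ℕ)) = (q : ℕ))
    (n : Finset (AdmQ W K p)) (μ : Bool) (y : Vp W₀ K p) :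
    θ y ∈ SelQP W K p c n μ ↔ y ∈ SelQP W₀ K p c (eA.finsetCongr n) μ := by
  have heA' : ∀ q₀ : AdmQ W₀ K p, ((eA.symm q₀ : ℕ)) = (q₀ : ℕ) := fun q₀ ↦ by
    conv_rhs => rw [← eA.apply_symm_apply q₀]
    exact (heA _).symm
  -- the index conditions «above no prime of the level» agree
  have hoff : ∀ v : HeightOneSpectrum (𝓞 K), (∀ q ∈ n, ((q : ℕ) : 𝓞 K) ∉ v.asIdeal) ↔
      ∀ q₀ ∈ eA.finsetCongr n, ((q₀ : ℕ) : 𝓞 K) ∉ v.asIdeal := by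
    intro v
    refine ⟨fun h q₀ hq₀ ↦ ?_, fun h q hq ↦ ?_⟩
    · rw [Equiv.finsetCongr_apply, Finset.mem_map_equiv] at hq₀
      rw [← heA' q₀]
      exact h _ hq₀
    · have hq' : eA q ∈ eA.finsetCongr n := by
        rw [Equiv.finsetCongr_apply, Finset.mem_map_equiv, Equiv.symm_apply_apply]
        exact hq
      rw [← heA q]
      exact h _ hq'
  rw [mem_selQP_iff, mem_selQP_iff]
  refine ⟨fun ⟨h1, _, h3, h4⟩ ↦ ⟨?_, ?_, fun v hv ↦ ?_, fun q₀ hq₀ v hv ↦ ?_⟩,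
    fun ⟨h1, _, h3, h4⟩ ↦ ⟨?_, ?_, fun v hv ↦ ?_, fun q hq v hv ↦ ?_⟩⟩
  · apply θ.injective
    rw [hθc, h1, map_zsmul]
  · exact fun w ↦ mem_selmerLocalKer_infinitePlace_of_isImaginaryQuadratic hK _ w y
  · exact (hθK v y).mp (h3 v ((hoff v).mpr hv))
  · rw [Equiv.finsetCongr_apply, Finset.mem_map_equiv] at hq₀
    have hv' : (((eA.symm q₀ : AdmQ W K p) : ℕ) : 𝓞 K) ∈ v.asIdeal := by rw [heA' q₀]; exact hv
    exact (hθT v y).mp (h4 _ hq₀ v hv')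
  · rw [← hθc, h1, map_zsmul]
  · exact fun w ↦ mem_selmerLocalKer_infinitePlace_of_isImaginaryQuadratic hK _ w (θ y)
  · exact (hθK v y).mpr (h3 v ((hoff v).mp hv))
  · have hq' : eA q ∈ eA.finsetCongr n := by
      rw [Equiv.finsetCongr_apply, Finset.mem_map_equiv, Equiv.symm_apply_apply]
      exact hq
    have hv' : (((eA q : AdmQ W₀ K p) : ℕ) : 𝓞 K) ∈ v.asIdeal := by rw [heA q]; exact hv
    exact (hθT v y).mpr (h4 _ hq' v hv')

/-- **The canonical spaces of congruent curves have the same dimension at every level** (the crux idea's stub (A1)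
«Selmer identity at every level `n`», REDUCED to the per-place identifications (θc), (θK), (θT)):
`dim Sel_n^μ(E) = dim Sel_{n}^μ(E₀)`. Proof: `Sel_n^μ(E)` is the image of `Sel_n^μ(E₀)` under the `𝔽_p`-linear
isomorphism `θ`. [cite: WZhang2014, §5] -/
theorem finrank_selQP_eq_of_congr (hK : IsImaginaryQuadratic K) (θ : Vp W₀ K p ≃+ Vp W K p)
    (hθc : ∀ y, θ (conjAct W₀ c ((p ^ 1 : ℕ) : ℤ) y) = conjAct W c ((p ^ 1 : ℕ) : ℤ) (θ y))
    (hθK : ∀ (v : HeightOneSpectrum (𝓞 K)) (y : Vp W₀ K p),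
      θ y ∈ selmerLocalKer (W.baseChange K) (v.adicCompletion K) ((p ^ 1 : ℕ) : ℤ) ↔
        y ∈ selmerLocalKer (W₀.baseChange K) (v.adicCompletion K) ((p ^ 1 : ℕ) : ℤ))
    (hθT : ∀ (v : HeightOneSpectrum (𝓞 K)) (y : Vp W₀ K p),
      θ y ∈ toricLocalKer (W.baseChange K) (v.adicCompletion K) ((p ^ 1 : ℕ) : ℤ) ↔
        y ∈ toricLocalKer (W₀.baseChange K) (v.adicCompletion K) ((p ^ 1 : ℕ) : ℤ))
    (eA : AdmQ W K p ≃ AdmQ W₀ K p) (heA : ∀ q, ((eA q : ℕ)) = (q : ℕ))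
    (n : Finset (AdmQ W K p)) (μ : Bool) :
    finrank (ZMod p) (SelQP W K p c n μ) = finrank (ZMod p) (SelQP W₀ K p c (eA.finsetCongr n) μ) := by
  -- `θ` as an `𝔽_p`-linear equivalence
  let θₗ : Vp W₀ K p ≃ₗ[ZMod p] Vp W K p :=
    { θ.toAddMonoidHom.toZModLinearMap p with
      toFun := θ, invFun := θ.symm, left_inv := θ.left_inv, right_inv := θ.right_inv }
  have hθₗ : ∀ y, θₗ y = θ y := fun _ ↦ rfl
  have hmap : SelQP W K p c n μ = (SelQP W₀ K p c (eA.finsetCongr n) μ).map (θₗ : Vp W₀ K p →ₗ[ZMod p] Vp W K p) := by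
    ext x
    rw [Submodule.mem_map]
    constructor
    · intro hx
      refine ⟨θ.symm x, ?_, ?_⟩
      · have h := (mem_selQP_iff_of_congr W W₀ K p c hK θ hθc hθK hθT eA heA n μ (θ.symm x)).mp
        rw [θ.apply_symm_apply] at h
        exact h hx
      · change θₗ (θ.symm x) = x
        rw [hθₗ, θ.apply_symm_apply]
    · rintro ⟨y, hy, rfl⟩
      change θₗ y ∈ _
      rw [hθₗ]
      exact (mem_selQP_iff_of_congr W W₀ K p c hK θ hθc hθK hθT eA heA n μ y).mpr hy
  rw [hmap]
  exact LinearEquiv.finrank_map_eq θₗ _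

/-! ## §2 The transfer -/

variable [W.IsElliptic] [Fact p.Prime] [NeZero (W.conductorNorm ℤ)] [NeZero (W₀.conductorNorm ℤ)]

/-- **LEVEL KOLYVAGIN SYSTEMS TRANSFER ALONG A CONGRUENCE, modulo local identifications and a bottom transfer.**
Frame: `K` imaginary quadratic, Heegner for `N_E`, `4N ∣ β² − d_K` (E's Kolyvagin–Heegner data exist), complex conjugation
`c`. Lender: `E₀ = W₀` with data `Dt₀, β₀` and a level Kolyvagin system `S₀ : LevelKolyvaginSystemP W₀ K p Dt₀ β₀ ι c`.
Bridge: `θ : H¹(K, E₀[p]) ≃ H¹(K, E[p])` additive with (θc) conjugation-compatibility, (θ0) local triviality, (θK) Kummer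
and (θT) toric conditions IDENTIFIED at every finite place, (θTr) E₀'s transverse condition carried into E's; (Kol), (Adm):
the Kolyvagin primes and the admissible primes of the two curves coincide (as predicates on `ℕ`). Glue: (A2) BOTTOM
TRANSFER — if some Kolyvagin–Heegner datum of `E₀` (conductor a product of Kolyvagin primes) has non-zero Kolyvagin class
mod `p`, so does some datum of `E`. THEN `LevelKolyvaginSystemP W K p Dt β ι c` is inhabited: E's own classes at level
`∅`, `θ ∘ S₀.κ` (indices matched) above `∅`; the upper-level axioms, `transport` between non-empty levels and `baseCase`
transfer through `θ` (`finrank_selQP_eq_of_congr`), and `transport` from the bottom `∅` is `S₀.transport` +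
`S₀.realisation` + (A2) (`nonempty_levelKolyvaginSystemP_of_upperLevels_of_bottomTransfer`). The composition of
`depleted-shadow-transfer` (A1)–(A3) ∕ `pold-fusion-glue`. [cite: WZhang2014, Thm. 4.3, Thm. 7.2, §9]
[cite: KrizLi2019, Thm. 1.16] [cite: GrossLMS1991, §4 (4.4)] -/
theorem nonempty_levelKolyvaginSystemP_of_congr
    (Dt : ModularParametrizationData W (W.conductorNorm ℤ)) (β : ℤ) (ι : K →+* ℂ)
    (Dt₀ : ModularParametrizationData W₀ (W₀.conductorNorm ℤ)) (β₀ : ℤ)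
    (hK : IsImaginaryQuadratic K) (hH : SatisfiesHeegnerHypothesis (W.conductorNorm ℤ) K)
    (hβ : (4 * (W.conductorNorm ℤ : ℤ)) ∣ β ^ 2 - NumberField.discr K)
    (θ : Vp W₀ K p ≃+ Vp W K p)
    (hθc : ∀ y, θ (conjAct W₀ c ((p ^ 1 : ℕ) : ℤ) y) = conjAct W c ((p ^ 1 : ℕ) : ℤ) (θ y))
    (hθ0 : ∀ (v : HeightOneSpectrum (𝓞 K)) (y : Vp W₀ K p),
      θ y ∈ (W.baseChange K).torsionLocalKer (v.adicCompletion K) ((p ^ 1 : ℕ) : ℤ) ↔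
        y ∈ (W₀.baseChange K).torsionLocalKer (v.adicCompletion K) ((p ^ 1 : ℕ) : ℤ))
    (hθK : ∀ (v : HeightOneSpectrum (𝓞 K)) (y : Vp W₀ K p),
      θ y ∈ selmerLocalKer (W.baseChange K) (v.adicCompletion K) ((p ^ 1 : ℕ) : ℤ) ↔
        y ∈ selmerLocalKer (W₀.baseChange K) (v.adicCompletion K) ((p ^ 1 : ℕ) : ℤ))
    (hθT : ∀ (v : HeightOneSpectrum (𝓞 K)) (y : Vp W₀ K p),
      θ y ∈ toricLocalKer (W.baseChange K) (v.adicCompletion K) ((p ^ 1 : ℕ) : ℤ) ↔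
        y ∈ toricLocalKer (W₀.baseChange K) (v.adicCompletion K) ((p ^ 1 : ℕ) : ℤ))
    (hθTr : ∀ (ℓ : ℕ) (v : HeightOneSpectrum (𝓞 K)) (y : Vp W₀ K p),
      y ∈ transverseLocalKerP W₀ K p ι ℓ v → θ y ∈ transverseLocalKerP W K p ι ℓ v)
    (hKol : ∀ ℓ : ℕ, Zhang2014.IsKolyvaginPrime (W.conductorNorm ℤ) W K p ℓ ↔
      Zhang2014.IsKolyvaginPrime (W₀.conductorNorm ℤ) W₀ K p ℓ)
    (hAdm : ∀ q : ℕ, BertoliniDarmon2005.IsAdmissiblePrime (W.conductorNorm ℤ) K (fun ℓ ↦ W.frobeniusTrace ℓ) p 1 q ↔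
      BertoliniDarmon2005.IsAdmissiblePrime (W₀.conductorNorm ℤ) K (fun ℓ ↦ W₀.frobeniusTrace ℓ) p 1 q)
    (S₀ : LevelKolyvaginSystemP W₀ K p Dt₀ β₀ ι c)
    (hA2 : (∃ (m₀ : Finset {ℓ // Zhang2014.IsKolyvaginPrime (W₀.conductorNorm ℤ) W₀ K p ℓ})
        (d₀ : KolyvaginHeegnerData Dt₀ β₀ ι (∏ ℓ ∈ m₀, (ℓ : ℕ))), d₀.kolyvaginClass (Fact.out : p.Prime) 1 ≠ 0) →
      ∃ (m : Finset {ℓ // Zhang2014.IsKolyvaginPrime (W.conductorNorm ℤ) W K p ℓ})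
        (d : KolyvaginHeegnerData Dt β ι (∏ ℓ ∈ m, (ℓ : ℕ))), d.kolyvaginClass (Fact.out : p.Prime) 1 ≠ 0) :
    Nonempty (LevelKolyvaginSystemP W K p Dt β ι c) := by
  have hp : p.Prime := Fact.out
  -- the index identifications
  let eK : {ℓ // Zhang2014.IsKolyvaginPrime (W.conductorNorm ℤ) W K p ℓ} ≃
      {ℓ // Zhang2014.IsKolyvaginPrime (W₀.conductorNorm ℤ) W₀ K p ℓ} := Equiv.subtypeEquivRight hKol
  let eA : AdmQ W K p ≃ AdmQ W₀ K p := Equiv.subtypeEquivRight hAdm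
  -- (the underlying naturals agree — by the `simps` lemmas, NOT by `rfl`: a kernel `rfl` here would try to unify the
  -- two admissibility ∕ Kolyvagin predicates before projecting)
  have heK : ∀ ℓ, ((eK ℓ : ℕ)) = (ℓ : ℕ) := fun ℓ ↦ Equiv.subtypeEquivRight_apply_coe hKol ℓ
  have heA : ∀ q, ((eA q : ℕ)) = (q : ℕ) := fun q ↦ Equiv.subtypeEquivRight_apply_coe hAdm q
  have heA' : ∀ q₀ : AdmQ W₀ K p, ((eA.symm q₀ : ℕ)) = (q₀ : ℕ) := fun q₀ ↦
    Equiv.subtypeEquivRight_symm_apply_coe hAdm q₀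
  have heK' : ∀ ℓ₀ : {ℓ // Zhang2014.IsKolyvaginPrime (W₀.conductorNorm ℤ) W₀ K p ℓ}, ((eK.symm ℓ₀ : ℕ)) = (ℓ₀ : ℕ) :=
    fun ℓ₀ ↦ Equiv.subtypeEquivRight_symm_apply_coe hKol ℓ₀
  set EK := eK.finsetCongr with hEK
  set EA := eA.finsetCongr with hEA
  have hEA_mem : ∀ (n : Finset (AdmQ W K p)) (q₀ : AdmQ W₀ K p), q₀ ∈ EA n ↔ eA.symm q₀ ∈ n := fun n q₀ ↦ by
    rw [hEA, Equiv.finsetCongr_apply, Finset.mem_map_equiv]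
  have hEK_mem : ∀ (m : Finset {ℓ // Zhang2014.IsKolyvaginPrime (W.conductorNorm ℤ) W K p ℓ}) ℓ₀,
      ℓ₀ ∈ EK m ↔ eK.symm ℓ₀ ∈ m := fun m ℓ₀ ↦ by
    rw [hEK, Equiv.finsetCongr_apply, Finset.mem_map_equiv]
  have hEA_mem' : ∀ (n : Finset (AdmQ W K p)) (q : AdmQ W K p), eA q ∈ EA n ↔ q ∈ n := fun n q ↦ by
    rw [hEA_mem, Equiv.symm_apply_apply]
  have hEK_mem' : ∀ (m : Finset {ℓ // Zhang2014.IsKolyvaginPrime (W.conductorNorm ℤ) W K p ℓ}) ℓ,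
      eK ℓ ∈ EK m ↔ ℓ ∈ m := fun m ℓ ↦ by
    rw [hEK_mem, Equiv.symm_apply_apply]
  have hEA_card : ∀ n : Finset (AdmQ W K p), (EA n).card = n.card := fun n ↦ by
    rw [hEA, Equiv.finsetCongr_apply, Finset.card_map]
  have hEK_card : ∀ m : Finset {ℓ // Zhang2014.IsKolyvaginPrime (W.conductorNorm ℤ) W K p ℓ}, (EK m).card = m.card :=
    fun m ↦ by rw [hEK, Equiv.finsetCongr_apply, Finset.card_map]
  have hEA_ne : ∀ n : Finset (AdmQ W K p), (EA n).Nonempty ↔ n.Nonempty := fun n ↦ by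
    rw [hEA, Equiv.finsetCongr_apply, Finset.map_nonempty]
  have hEA_insert : ∀ (q : AdmQ W K p) (n : Finset (AdmQ W K p)), EA (insert q n) = insert (eA q) (EA n) :=
    fun q n ↦ by
      ext x
      rw [hEA_mem, Finset.mem_insert, Finset.mem_insert, hEA_mem, Equiv.symm_apply_eq]
  have hEK_insert : ∀ ℓ (m : Finset {ℓ // Zhang2014.IsKolyvaginPrime (W.conductorNorm ℤ) W K p ℓ}),
      EK (insert ℓ m) = insert (eK ℓ) (EK m) :=
    fun ℓ m ↦ by
      ext x
      rw [hEK_mem, Finset.mem_insert, Finset.mem_insert, hEK_mem, Equiv.symm_apply_eq]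
  have hEA_empty : EA ∅ = ∅ := by rw [hEA, Equiv.finsetCongr_apply, Finset.map_empty]
  have hEK_empty : EK ∅ = ∅ := by rw [hEK, Equiv.finsetCongr_apply, Finset.map_empty]
  -- the borrowed classes
  let κ₁ : Finset {ℓ // Zhang2014.IsKolyvaginPrime (W.conductorNorm ℤ) W K p ℓ} → Finset (AdmQ W K p) → Vp W K p :=
    fun m n ↦ θ (S₀.κ (EK m) (EA n))
  have hκ₁ : ∀ m n, κ₁ m n = θ (S₀.κ (EK m) (EA n)) := fun _ _ ↦ rfl
  -- the base locus transfers
  have hbase : ∀ (n : Finset (AdmQ W K p)) (q : AdmQ W K p),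
      q ∉ baseLocusQP W K p κ₁ n → eA q ∉ baseLocusQP W₀ K p S₀.κ (EA n) := by
    intro n q hq hq₀
    apply hq
    intro m v hv
    rw [hκ₁, hθ0]
    exact hq₀ (EK m) v (by rw [heA]; exact hv)
  refine nonempty_levelKolyvaginSystemP_of_upperLevels_of_bottomTransfer W K p c Dt β ι hK hH hβ
    (fun n ↦ S₀.ε₀ (EA n)) κ₁ ?_ ?_ ?_ ?_ ?_ ?_ ?_ ?_ ?_
  · -- sign
    intro n hn m
    rw [hκ₁, ← hθc, S₀.sign (EA n) ((hEA_ne n).mpr hn) (EK m), map_zsmul, hEK_card]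
  · -- selmer_off
    intro n hn m v hm hq
    rw [hκ₁, hθK]
    refine S₀.selmer_off (EA n) ((hEA_ne n).mpr hn) (EK m) v (fun ℓ₀ hℓ₀ ↦ ?_) (fun q₀ hq₀ ↦ ?_)
    · rw [← heK' ℓ₀]; exact hm _ ((hEK_mem m ℓ₀).mp hℓ₀)
    · rw [← heA' q₀]; exact hq _ ((hEA_mem n q₀).mp hq₀)
  · -- selmer_inf (empty condition at the complex places)
    intro n _ m w
    exact mem_selmerLocalKer_infinitePlace_of_isImaginaryQuadratic hK _ w _
  · -- toric_on
    intro n hn m q hq v hv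
    rw [hκ₁, hθT]
    exact S₀.toric_on (EA n) ((hEA_ne n).mpr hn) (EK m) (eA q) ((hEA_mem' n q).mpr hq) v (by rw [heA]; exact hv)
  · -- transverse_on
    intro n hn m ℓ hℓ v hv
    rw [hκ₁]
    have h := S₀.transverse_on (EA n) ((hEA_ne n).mpr hn) (EK m) (eK ℓ) ((hEK_mem' m ℓ).mpr hℓ) v
      (by rw [heK]; exact hv)
    rw [heK] at h
    exact hθTr ℓ v _ h
  · -- relation
    intro n hn m ℓ hℓ v hv
    rw [hκ₁, hκ₁, hθ0, hθ0, hEK_insert]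
    have h := S₀.relation (EA n) ((hEA_ne n).mpr hn) (EK m) (eK ℓ) (fun h ↦ hℓ ((hEK_mem' m ℓ).mp h)) v
      (by rw [heK]; exact hv)
    exact h
  · -- transport between non-empty levels
    intro n q₁ q₂ _ hq₁ hq₂ hb
    have hb₀ := hbase _ q₂ hb
    rw [hEA_insert, hEA_insert] at hb₀
    obtain ⟨m₀, hm₀⟩ := S₀.transport (EA n) (eA q₁) (eA q₂) (fun h ↦ hq₁ ((hEA_mem' n q₁).mp h))
      (fun h ↦ hq₂ (by
        rw [Finset.mem_insert] at h ⊢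
        rcases h with h | h
        · exact Or.inl (eA.injective h)
        · exact Or.inr ((hEA_mem' n q₂).mp h))) hb₀
    refine ⟨EK.symm m₀, ?_⟩
    rw [hκ₁, Equiv.apply_symm_apply, θ.map_ne_zero_iff]
    exact hm₀
  · -- the bottom transfer: S₀.transport at `∅`, S₀.realisation, (A2)
    intro q₁ q₂ hne hb
    have hb₀ := hbase _ q₂ hb
    rw [hEA_insert, hEA_insert, hEA_empty] at hb₀
    obtain ⟨m₀, hm₀⟩ := S₀.transport ∅ (eA q₁) (eA q₂) (Finset.notMem_empty _)
      (fun h ↦ hne (eA.injective (Finset.mem_singleton.mp (by simpa using h)))) hb₀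
    obtain ⟨d₀, hd₀⟩ := S₀.realisation m₀
    exact hA2 ⟨m₀, d₀, by rw [← hd₀]; exact hm₀⟩
  · -- base case
    intro n hn he h1
    rw [hκ₁, hEK_empty, θ.map_ne_zero_iff]
    refine S₀.baseCase (EA n) ((hEA_ne n).mpr hn) (by rw [hEA_card]; exact he) ?_
    rw [← finrank_selQP_eq_of_congr W W₀ K p c hK θ hθc hθK hθT eA heA n true,
      ← finrank_selQP_eq_of_congr W W₀ K p c hK θ hθc hθK hθT eA heA n false]
    exact h1

end Summit.BirchSwinnertonDyer.BirchSwinnertonDyer.Theorems.AdditiveKoly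

end
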